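import Literature.NumberTheory.Transcendental.QuadraticRelationsLogarithmsSec3Final
import HarnessLib

/-!
# Roy–Waldschmidt 1997, Théorème 0.2: decomposition into Théorème 2.1 and Théorème 4.1

Topic `Literature/NumberTheory/Transcendental`. SPLIT of the named fact
`Literature.NumberTheory.Transcendental.royWaldschmidt_quadratic_thm_0_2`
(`QuadraticRelationsLogarithms.lean`; D. Roy, M. Waldschmidt, *Approximation diophantienne et
indépendance algébrique de logarithmes*, Ann. Sci. ÉNS (4) 30 (1997) 753–796, Théorème 0.2) into
the two printed inputs that the tree does not yet prove, following the PROVED assembly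
`RoyWaldschmidt1997.royWaldschmidt_quadratic_thm_0_2_of_thm_2_1_of_thm_4_1`
(`QuadraticRelationsLogarithmsSec3Final.lean`): the whole printed chain Théorème 0.2 ⇐ 0.1 ⇐
Corollaire 1.4 ⇐ 1.3 ⇐ Théorème 1.1 ⇐ Théorème 5.1 (§§5–6, with Proposition 6.1, Théorème 3.2 and
Théorème 3.1) is a theorem of the tree (`…Thm01`, `…Cor14`, `…Cor13`, `…Thm11`, `…Sec6*`,
`…Sec5*`, `…Sec3Thm31`), and what remains is

* `royWaldschmidt1997_thm_2_1` — Théorème 2.1 of the paper (pp. 761–762), the special case of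
  Waldschmidt's effective linear subgroup theorem (M. Waldschmidt, J. reine angew. Math. 493 (1997),
  Théorème 2.1 = reference [33] of the paper; "the paper's only external theorem"), verbatim as
  hypothesis `h21` of the assembly, over the tree's apparatus `LinGroup d₀ d₁ = ℂ^{d₀} × (ℂˣ)^{d₁}`,
  connected algebraic subgroups `LinGroup.ConnAlgSubgroup`, Weil heights `weilHeight₁`;
* `royWaldschmidt1997_thm_4_1` — Théorème 4.1 of the paper (p. 772: descent of the obstruction
  subgroup along a place of a function field of transcendence degree `1`), verbatim as hypothesis
  `h41`, over the tree's places `RoyWaldschmidt1997.Place K`, reductions `Place.IsReduction`,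
  function-field heights `ffHeight₁` (its linear core is proved: `thm_4_1_linear_core`,
  `…Sec4Thm41Core.lean`; `…Sec4Torus.lean`, `…Sec4Step2.lean` continue it);

and the PROVED assembly `royWaldschmidt_quadratic_thm_0_2_holds_of`.

## References

* D. Roy, M. Waldschmidt, *Approximation diophantienne et indépendance algébrique de logarithmes*,
  Ann. Sci. École Norm. Sup. (4) 30 (1997) 753–796: Théorème 0.2 p. 755, Théorème 2.1 pp. 761–762,
  Théorème 3.1 p. 763, Théorème 4.1 p. 772, §5 pp. 779–784. [RoyWaldschmidt1997ENS]
* M. Waldschmidt, *Approximation diophantienne dans les groupes algébriques commutatifs (I): une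
  version effective du théorème du sous-groupe algébrique*, J. reine angew. Math. 493 (1997) 61–113,
  Théorème 2.1. [Waldschmidt1997Crelle]
-/

noncomputable section

open Complex IntermediateField Module Submodule

namespace Literature.NumberTheory.Transcendental

open RoyWaldschmidt1997 LiePresentation LinGroup

/-! ## The children (named facts) -/

/-- NAMED FACT (Roy–Waldschmidt 1997, Théorème 2.1, pp. 761–762 = Waldschmidt, J. reine angew.
Math. 493 (1997), Théorème 2.1: the effective linear subgroup theorem in the form used in §5 of the
paper). Data: points `w₁,…,w_{ℓ₀}` and `η_j` (`j ∈ N`) of `ℂ^{d₀} × ℂ^{d₁}` (the second block read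
through `exp` in `G = 𝔾ₐ^{d₀} × 𝔾ₘ^{d₁}`), approximations `w̃_j, η̃_j` with coordinates (resp.
exponentials of the toric coordinates) in a number field `K̃`, one `η̃_j` with `exp η̃_j = 1`, one
`η_j` with nonzero toric part, and parameters `A_i, B₁, B₂, E ≥ e`, `U, V > 0`, `S₀, T₀, T₁ ≥ 1`
subject to the printed height conditions (`h(η̃) ≤ log B₁`, `h(w̃_j) ≤ log B₂`,
`h(e^{η̃_{ji}}), 2/[K̃:ℚ], E|η̃_{ji}|/[K̃:ℚ] ≤ log A_i`), approximation conditions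
(`|w_j − w̃_j|, |η_j − η̃_j| ≤ e^{−V}`) and the inequalities linking `U, V, E, B₁, B₂, S₀, T₀, T₁`
(`[K̃:ℚ] T₀ log B₁ ≤ U`, …, `(12(d₀+d₁)+13) U ≤ V`, …,
`4 (V/log E)^{dim ⟨w, η⟩} ≤ C(T₀+d₀, d₀) (T₁+1)^{d₁}`). Conclusion: there is a connected algebraic
subgroup `H ≠ G` of `G`, whose additive part is `K̃`-rational and which is cut out by polynomials
with coefficients in `K̃` of partial degrees `≤ T₁` in the toric variables, satisfying the printed
counting inequality
`S₀^{rk w̃ − rk(w̃ ∩ T_eH)} · #((exp η̃) mod H) · T₀^{dim H_a} · T₁^{dim H_m} ≤ (d₀+d₁)!/d₀! · T₀^{d₀} T₁^{d₁}`.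
Verbatim hypothesis `h21` of `royWaldschmidt_quadratic_thm_0_2_of_thm_2_1_of_thm_4_1`
(apparatus: `LinGroup`, `LinGroup.ConnAlgSubgroup`, `LiePresentation.IsKRational`, `weilHeight₁`
of the `QuadraticRelationsLogarithms*` files). Users take `(h : royWaldschmidt1997_thm_2_1)`.
[cite: RoyWaldschmidt1997ENS, Théorème 2.1 (pp. 761–762)] [cite: Waldschmidt1997Crelle, Théorème 2.1] -/
def royWaldschmidt1997_thm_2_1 : Prop :=
  ∀ (d₀ d₁ ℓ₀ : ℕ) (N : Type) [Fintype N] (w : Fin ℓ₀ → (Fin d₀ → ℂ) × (Fin d₁ → ℂ))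
    (η : N → (Fin d₀ → ℂ) × (Fin d₁ → ℂ))
    (Kt : IntermediateField ℚ ℂ) [FiniteDimensional ℚ Kt]
    (wt : Fin ℓ₀ → (Fin d₀ → ℂ) × (Fin d₁ → ℂ)) (ηt : N → (Fin d₀ → ℂ) × (Fin d₁ → ℂ))
    (A : Fin d₁ → ℝ) (B₁ B₂ E U V : ℝ) (S₀ T₀ T₁ : ℕ),
    (∀ j, (∀ i, (wt j).1 i ∈ Kt) ∧ ∀ i, (wt j).2 i ∈ Kt) →
    (∀ j, (∀ i, (ηt j).1 i ∈ Kt) ∧ ∀ i, cexp ((ηt j).2 i) ∈ Kt) →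
    (∃ j, LinGroup.exp (ηt j) = 1) →
    (∃ j, (η j).2 ≠ 0) →
    (∀ i, Real.exp 1 ≤ A i) → Real.exp 1 ≤ B₁ → Real.exp 1 ≤ B₂ → Real.exp 1 ≤ E → 0 < U → 0 < V →
    0 < S₀ → 0 < T₀ → 0 < T₁ → 2 * ((d₀ : ℝ) + d₁) ≤ B₁ → ((d₀ : ℝ) + d₁) ≤ B₂ →
    (∀ i : Fin d₀, weilHeight₁ Kt (fun j : N => (ηt j).1 i) ≤ Real.log B₁) →
    (∀ j, weilHeight₁ Kt (Sum.elim (wt j).1 (wt j).2 : Fin d₀ ⊕ Fin d₁ → ℂ) ≤ Real.log B₂) →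
    (∀ (i : Fin d₁) (j : N), weilHeight₁ Kt (fun _ : Unit => cexp ((ηt j).2 i)) ≤ Real.log (A i) ∧
    2 / (Module.finrank ℚ Kt : ℝ) ≤ Real.log (A i) ∧
    E / (Module.finrank ℚ Kt : ℝ) * ‖(ηt j).2 i‖ ≤ Real.log (A i)) →
    (∀ j, ‖w j - wt j‖ ≤ Real.exp (-V)) → (∀ j, ‖η j - ηt j‖ ≤ Real.exp (-V)) →
    (Module.finrank ℚ Kt : ℝ) * (T₀ * Real.log B₁) ≤ U →
    (Module.finrank ℚ Kt : ℝ) * (S₀ * Real.log B₂) ≤ U →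
    (Module.finrank ℚ Kt : ℝ) * (T₁ * ∑ i, Real.log (A i)) ≤ U →
    (12 * ((d₀ : ℝ) + d₁) + 13) * U ≤ V →
    Real.log E ≤ (Module.finrank ℚ Kt : ℝ) * Real.log B₁ →
    Real.log E ≤ (Module.finrank ℚ Kt : ℝ) * Real.log B₂ →
    ((d₀ : ℝ) + d₁) * S₀ + T₀ + d₁ * T₁ ≤ B₂ →
    ((Nat.choose (T₀ + d₀) d₀ : ℝ) * ((T₁ : ℝ) + 1) ^ d₁ ≤ 1 / 8 * Real.exp (U / (2 * Module.finrank ℚ Kt))) →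
    (4 * (V / Real.log E) ^ (Module.finrank ℂ (Submodule.span ℂ (Set.range w ∪ Set.range η))) ≤
    (Nat.choose (T₀ + d₀) d₀ : ℝ) * ((T₁ : ℝ) + 1) ^ d₁) →
    ∃ H : LinGroup.ConnAlgSubgroup d₀ d₁,
    H.tangent ≠ ⊤ ∧ LiePresentation.IsKRational Kt H.addPart ∧
    (∃ F : Set (MvPolynomial (Fin d₀ ⊕ Fin d₁) ℂ),
    (∀ P ∈ F, (∀ m, P.coeff m ∈ Kt) ∧ ∀ i : Fin d₁, P.degreeOf (Sum.inr i) ≤ T₁) ∧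
    (∀ g ∈ H.toSubgroup, ∀ P ∈ F, LinGroup.evalAt P g = 0) ∧
    ∀ H' : LinGroup.ConnAlgSubgroup d₀ d₁, H.toSubgroup ≤ H'.toSubgroup →
    (∀ g ∈ H'.toSubgroup, ∀ P ∈ F, LinGroup.evalAt P g = 0) → H'.toSubgroup = H.toSubgroup) ∧
    S₀ ^ (Module.finrank Kt ↥(Submodule.span Kt (Set.range wt)) -
    Module.finrank Kt ↥(Submodule.span Kt (Set.range wt) ⊓ (H.tangent.restrictScalars Kt))) *
    Set.ncard ((QuotientGroup.mk : LinGroup d₀ d₁ → LinGroup d₀ d₁ ⧸ H.toSubgroup) ''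
    Set.range (fun j => LinGroup.exp (ηt j))) *
    T₀ ^ H.addDim * T₁ ^ H.torusDim ≤
    (d₀ + d₁).factorial / d₀.factorial * T₀ ^ d₀ * T₁ ^ d₁

/-- NAMED FACT (Roy–Waldschmidt 1997, Théorème 4.1, p. 772: the descent along a place). Let `K` be a
finitely generated subfield of `ℂ` of transcendence degree `1` over `ℚ`, `𝔭` a place of `K` (a
valuation ring `𝔭.ring ⊆ K` with residue degree `𝔭.deg`) with a reduction map `τ : 𝔭.ring → ℂ`
landing in a number field `K̃` with `[K̃ : ℚ] = deg 𝔭`; let `w₁, …, w_{ℓ₀} ∈ K^{d₀+d₁}` be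
`K`-linearly independent, `γ_j ∈ G(K) = K^{d₀} × (Kˣ)^{d₁}` (`j ∈ N`), all with coordinates in
`𝔭.ring` (units for the toric ones), with reductions `w̃_j`, `γ̃_j`; let `H` be a connected
algebraic subgroup of `G` whose additive part is `K̃`-rational, cut out by polynomials over `K̃` of
toric partial degrees `≤ T₁`; and let `A'_i, B₁, B₂ ≥ e` bound the function-field heights
(`ffHeight₁`) of the additive coordinates of the `γ_j` (`≤ log B₁`), of the `w_j` (`≤ log B₂`) and
of the toric coordinates (`≤ log A'_i`), with
`max(2 d₁ T₁ ∑ log A'_i, 2 d₀ log B₁ + ℓ₀ log B₂) < deg 𝔭`. Then there is a connected algebraic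
subgroup `L` of `G`, with `K`-rational additive part and the same additive and toric dimensions as
`H`, such that `#(γ mod L) ≤ #(γ̃ mod H)` and
`rk_K w − rk_K(w ∩ T_eL) ≤ rk_{K̃} w̃ − rk_{K̃}(w̃ ∩ T_eH)`. Verbatim hypothesis `h41` of
`royWaldschmidt_quadratic_thm_0_2_of_thm_2_1_of_thm_4_1` (apparatus: `RoyWaldschmidt1997.Place`,
`Place.IsReduction`, `Place.deg`, `ffHeight₁`, `LinGroup.ConnAlgSubgroup`; the linear core of the
printed proof is `thm_4_1_linear_core`). Users take `(h : royWaldschmidt1997_thm_4_1)`.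
[cite: RoyWaldschmidt1997ENS, Théorème 4.1 (p. 772)] -/
def royWaldschmidt1997_thm_4_1 : Prop :=
  ∀ (K : IntermediateField ℚ ℂ), K.FG → Algebra.trdeg ℚ K = 1 →
    ∀ (d₀ d₁ : ℕ) (p : Place K) (τ : p.ring →+* ℂ), p.IsReduction τ →
    ∀ (Kt : IntermediateField ℚ ℂ) [FiniteDimensional ℚ Kt], (∀ x, τ x ∈ Kt) → Module.finrank ℚ Kt = p.deg →
    ∀ (ℓ₀ : ℕ) (N : Type) [Fintype N] (T₁ : ℕ) (w : Fin ℓ₀ → (Fin d₀ → ℂ) × (Fin d₁ → ℂ))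
    (hw : ∀ j, (∀ i, (w j).1 i ∈ K) ∧ ∀ i, (w j).2 i ∈ K), LinearIndependent K w →
    ∀ (γ : N → LinGroup d₀ d₁)
    (hγ : ∀ j, (∀ i, Multiplicative.toAdd (γ j).1 i ∈ K) ∧ ∀ i, ((γ j).2 i : ℂ) ∈ K)
    (H : LinGroup.ConnAlgSubgroup d₀ d₁), LiePresentation.IsKRational Kt H.addPart →
    (∃ F : Set (MvPolynomial (Fin d₀ ⊕ Fin d₁) ℂ),
    (∀ P ∈ F, (∀ m, P.coeff m ∈ Kt) ∧ ∀ i : Fin d₁, P.degreeOf (Sum.inr i) ≤ T₁) ∧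
    (∀ g ∈ H.toSubgroup, ∀ P ∈ F, LinGroup.evalAt P g = 0) ∧
    ∀ H' : LinGroup.ConnAlgSubgroup d₀ d₁, H.toSubgroup ≤ H'.toSubgroup →
    (∀ g ∈ H'.toSubgroup, ∀ P ∈ F, LinGroup.evalAt P g = 0) → H'.toSubgroup = H.toSubgroup) →
    (∀ j, (∀ i, (⟨(w j).1 i, (hw j).1 i⟩ : K) ∈ p.ring) ∧ ∀ i, (⟨(w j).2 i, (hw j).2 i⟩ : K) ∈ p.ring) →
    (∀ j, (∀ i, (⟨Multiplicative.toAdd (γ j).1 i, (hγ j).1 i⟩ : K) ∈ p.ring) ∧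
    ∀ i, (⟨((γ j).2 i : ℂ), (hγ j).2 i⟩ : K) ∈ p.ring ∧ (⟨((γ j).2 i : ℂ)⁻¹, inv_mem ((hγ j).2 i)⟩ : K) ∈ p.ring) →
    ∀ (wt : Fin ℓ₀ → (Fin d₀ → ℂ) × (Fin d₁ → ℂ)) (γt : N → LinGroup d₀ d₁),
    (∀ j, (∀ i (h : (⟨(w j).1 i, (hw j).1 i⟩ : K) ∈ p.ring), (wt j).1 i = τ ⟨_, h⟩) ∧
    ∀ i (h : (⟨(w j).2 i, (hw j).2 i⟩ : K) ∈ p.ring), (wt j).2 i = τ ⟨_, h⟩) →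
    (∀ j, (∀ i (h : (⟨Multiplicative.toAdd (γ j).1 i, (hγ j).1 i⟩ : K) ∈ p.ring),
    Multiplicative.toAdd (γt j).1 i = τ ⟨_, h⟩) ∧
    ∀ i (h : (⟨((γ j).2 i : ℂ), (hγ j).2 i⟩ : K) ∈ p.ring), ((γt j).2 i : ℂ) = τ ⟨_, h⟩) →
    ∀ (A' : Fin d₁ → ℝ) (B₁ B₂ : ℝ), (∀ i, Real.exp 1 ≤ A' i) → Real.exp 1 ≤ B₁ → Real.exp 1 ≤ B₂ →
    (∀ i : Fin d₀, (ffHeight₁ (fun j : N => (⟨Multiplicative.toAdd (γ j).1 i, (hγ j).1 i⟩ : K)) : ℝ) ≤ Real.log B₁) →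
    (∀ j, (ffHeight₁ (Sum.elim (fun i => (⟨(w j).1 i, (hw j).1 i⟩ : K)) (fun i => (⟨(w j).2 i, (hw j).2 i⟩ : K))) : ℝ)
    ≤ Real.log B₂) →
    (∀ (i : Fin d₁) (j : N), (ffHeight₁ (fun _ : Unit => (⟨((γ j).2 i : ℂ), (hγ j).2 i⟩ : K)) : ℝ) ≤ Real.log (A' i)) →
    max (2 * (d₁ : ℝ) * ((T₁ : ℝ) * ∑ i, Real.log (A' i))) (2 * (d₀ : ℝ) * Real.log B₁ + ℓ₀ * Real.log B₂) < p.deg →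
    ∃ L : LinGroup.ConnAlgSubgroup d₀ d₁,
    LiePresentation.IsKRational K L.addPart ∧ L.addDim = H.addDim ∧ L.torusDim = H.torusDim ∧
    Set.ncard ((QuotientGroup.mk : LinGroup d₀ d₁ → LinGroup d₀ d₁ ⧸ L.toSubgroup) '' Set.range γ) ≤
    Set.ncard ((QuotientGroup.mk : LinGroup d₀ d₁ → LinGroup d₀ d₁ ⧸ H.toSubgroup) '' Set.range γt) ∧
    Module.finrank K ↥(Submodule.span K (Set.range w)) -
    Module.finrank K ↥(Submodule.span K (Set.range w) ⊓ (L.tangent.restrictScalars K)) ≤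
    Module.finrank Kt ↥(Submodule.span Kt (Set.range wt)) -
    Module.finrank Kt ↥(Submodule.span Kt (Set.range wt) ⊓ (H.tangent.restrictScalars Kt))

/-! ## The assembly (proved) -/

/-- **Roy–Waldschmidt's Théorème 0.2 from Théorème 2.1 and Théorème 4.1 (SPLIT assembly).**
`royWaldschmidt1997_thm_2_1 → royWaldschmidt1997_thm_4_1 → royWaldschmidt_quadratic_thm_0_2`, by
`RoyWaldschmidt1997.royWaldschmidt_quadratic_thm_0_2_of_thm_2_1_of_thm_4_1` (Théorèmes 0.1, 1.1,
3.1, 3.2, 5.1, Corollaires 1.3–1.4 and Proposition 6.1 are theorems of the tree).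
[cite: RoyWaldschmidt1997ENS, Théorème 0.2 p. 755; Théorème 2.1 pp. 761–762; Théorème 4.1 p. 772] -/
theorem royWaldschmidt_quadratic_thm_0_2_holds_of (h₁ : royWaldschmidt1997_thm_2_1)
    (h₂ : royWaldschmidt1997_thm_4_1) : royWaldschmidt_quadratic_thm_0_2 :=
  RoyWaldschmidt1997.royWaldschmidt_quadratic_thm_0_2_of_thm_2_1_of_thm_4_1 h₁ h₂

end Literature.NumberTheory.Transcendental
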